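import Mathlib
import Summits.MatrixMultiplication.MatrixMultiplication.Theses.LevelGradedCohnUmans
import Summits.MatrixMultiplication.MatrixMultiplication.Theorems.LevelGradedCohnUmansGradedDesignFamilyWreathLink
import Summits.MatrixMultiplication.MatrixMultiplication.Theorems.GradedDesignFamily.Negative.LoadBearing

/-!
# `GradedDesignFamily` at every exponent `2 + ε ≥ 2.82` — the axis family, certified on its finite core

Route `LevelGradedCohnUmans`, crux `GradedDesignFamily` (stmt-MatrixMultiplication-7610), registered stub
`cruxAt_of_le_082` (siege variation "certificate / decide on the finite core"; an independent companion of
`Theorems.GradedDesignFamily.cruxAt_of_le_082` in `…GradedDesignFamilyExponent082.lean`, which goes through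
the hand-checked family `abelianAxisFamily_of_le` in `C₁₇³`).

The witness is the Cohn–Kleinberg–Szegedy–Umans two-piece axis family — the first example of the
simultaneous triple product property: in `H = C_n³` with coordinate axes `H₀, H₁, H₂` the triples
`(H₀∖0, H₁∖0, H₂∖0)` and `(H₁∖0, H₂∖0, H₀∖0)` satisfy the STPP — in the ABELIAN base
`Multiplicative (Fin 3 → ZMod 16)`, read through the full test space `J = ⊤` and fed to the LANDED graded
wreath lift `gradedWreathLinkAt` of this crux (the non-abelian host is the permutation wreath product the
lift builds).  What this file adds is the way the base family is verified:

* `coordinate_pattern` proves the simultaneous separation pattern for ANY "coordinate labelling"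
  `cX cY cZ : Fin t → Fin d` of pieces by punctured axes of `(ZMod n)^d`, from two hypotheses on the
  finite label structure only — `hdiag` (the three pieces of one triple sit on distinct axes) and `hoff`
  (in an off-diagonal word `x⁻¹ y y'⁻¹ z · (x₀⁻¹ z₀)⁻¹` some letter sits on an axis met by no other letter)
  — through the uniform signed-sum lemma `single_survivor`; for the axis family (`d = 3`, `t = 2`) both
  hypotheses are closed by `decide`;
* `coordinateFamilyAt` packages any such labelling as a graded simultaneous family: the budget of `⊤`
  over an abelian base is `≤ |G| = n^d` (`Negative.gradedBudget_le_card_of_comm`), each piece has volume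
  `(n-1)³`, so the family inequality is the numeric hypothesis `n^d < t·((n-1)³)^{(2+ε)/3}`;
* `axis16_certificate`: `16³ = 4096 < 2·3375^{(2+ε)/3}` for `ε ≥ 41/50` is the exact integer certificate
  `2048⁵⁰ < 3375⁴⁷` (`norm_num`) plus monotonicity of `rpow` in the exponent (threshold `ε > 0.8155…`).

Sources: Cohn–Kleinberg–Szegedy–Umans 2005, §5 (the STPP and its first example) and §7 Thm. 7.1
(the wreath-product lift), here in the graded frame of Blasiak–Cohn–Grochow–Pratt–Umans 2024, Thm. 2.2.
-/

noncomputable section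

-- D-0017 layout: `Summit.<Summit>.<Problem>` repeats `MatrixMultiplication` (single-problem summit).
set_option linter.dupNamespace false

open scoped BigOperators
open Literature.RepresentationTheory.FiniteGroups
open Summit.MatrixMultiplication.MatrixMultiplication.Theses.LevelGradedCohnUmans

namespace Summit.MatrixMultiplication.MatrixMultiplication.Theorems.GradedDesignFamily.AxisCertificate

/-! ### Uniform algebra: a signed word sum with one surviving letter -/

/-- **One surviving letter.** The six letters `x, y, y', z, x₀, z₀` of the word `x⁻¹ y y'⁻¹ z (x₀⁻¹ z₀)⁻¹`
enter its additive form `-x + y - y' + z + x₀ - z₀` with signs `(-1, 1, -1, 1, 1, -1)`; if all letters but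
`k₀` vanish (at some coordinate) and the signed sum vanishes, then letter `k₀` vanishes too. [folklore] -/
theorem single_survivor {R : Type} [AddCommGroup R] (v : Fin 6 → R) (k₀ : Fin 6)
    (h0 : ∀ k, k ≠ k₀ → v k = 0)
    (hE : ∑ k, (![-1, 1, -1, 1, 1, -1] : Fin 6 → ℤ) k • v k = 0) : v k₀ = 0 := by
  rw [Finset.sum_eq_single k₀ (fun k _ hk => by rw [h0 k hk, smul_zero])
    (fun hk => absurd (Finset.mem_univ _) hk)] at hE
  fin_cases k₀ <;> simpa using hE

/-! ### The separation pattern of a coordinate labelling, from its finite core -/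

/-- **STPP pattern of a coordinate labelling.**  Pieces are punctured axes of `(ZMod n)^d` (written
multiplicatively): `X_a = H_{cX a}∖0`, `Y_a = H_{cY a}∖0`, `Z_a = H_{cZ a}∖0`.  If (`hdiag`) the three axes
of each triple are pairwise distinct and (`hoff`) every off-diagonal label word has a letter alone on
its axis, then a mixed quadruple product `x⁻¹ y y'⁻¹ z` (`x ∈ X_a, y ∈ Y_a, y' ∈ Y_b, z ∈ Z_b`) hits the
target `x₀⁻¹ z₀` of triple `i` (`x₀ ∈ X_i, z₀ ∈ Z_i`) only on the diagonal
`a = b = i, x = x₀, y = y', z = z₀` — the simultaneous triple product property in the crux's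
0/1-pattern form (Cohn–Kleinberg–Szegedy–Umans 2005, §5, for the axis labelling). [folklore] -/
theorem coordinate_pattern {n d t : ℕ} [NeZero n] (cX cY cZ : Fin t → Fin d)
    (hdiag : ∀ i, cX i ≠ cY i ∧ cY i ≠ cZ i ∧ cZ i ≠ cX i)
    (hoff : ∀ i a b : Fin t, ¬ (a = i ∧ b = i) → ∃ k₀ : Fin 6, ∀ k : Fin 6, k ≠ k₀ →
      (![cX a, cY a, cY b, cZ b, cX i, cZ i] : Fin 6 → Fin d) k ≠
        (![cX a, cY a, cY b, cZ b, cX i, cZ i] : Fin 6 → Fin d) k₀)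
    (i a b : Fin t) {x y y' z x₀ z₀ : Multiplicative (Fin d → ZMod n)}
    (hx : x ∈ ((Finset.univ : Finset (ZMod n)).erase 0).image
      fun r => Multiplicative.ofAdd (Pi.single (cX a) r))
    (hy : y ∈ ((Finset.univ : Finset (ZMod n)).erase 0).image
      fun r => Multiplicative.ofAdd (Pi.single (cY a) r))
    (hy' : y' ∈ ((Finset.univ : Finset (ZMod n)).erase 0).image
      fun r => Multiplicative.ofAdd (Pi.single (cY b) r))
    (hz : z ∈ ((Finset.univ : Finset (ZMod n)).erase 0).image
      fun r => Multiplicative.ofAdd (Pi.single (cZ b) r))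
    (hx₀ : x₀ ∈ ((Finset.univ : Finset (ZMod n)).erase 0).image
      fun r => Multiplicative.ofAdd (Pi.single (cX i) r))
    (hz₀ : z₀ ∈ ((Finset.univ : Finset (ZMod n)).erase 0).image
      fun r => Multiplicative.ofAdd (Pi.single (cZ i) r))
    (hE : x⁻¹ * y * y'⁻¹ * z = x₀⁻¹ * z₀) :
    a = i ∧ b = i ∧ x = x₀ ∧ y = y' ∧ z = z₀ := by
  classical
  simp only [Finset.mem_image, Finset.mem_erase, Finset.mem_univ, and_true, ne_eq]
    at hx hy hy' hz hx₀ hz₀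
  obtain ⟨rx, hrx, rfl⟩ := hx
  obtain ⟨ry, hry, rfl⟩ := hy
  obtain ⟨ry', hry', rfl⟩ := hy'
  obtain ⟨rz, hrz, rfl⟩ := hz
  obtain ⟨rx₀, hrx₀, rfl⟩ := hx₀
  obtain ⟨rz₀, hrz₀, rfl⟩ := hz₀
  -- the word, additively and coordinatewise, as a signed sum over its six letters
  have hco : ∀ c : Fin d, ∑ k : Fin 6, (![-1, 1, -1, 1, 1, -1] : Fin 6 → ℤ) k •
      (Pi.single ((![cX a, cY a, cY b, cZ b, cX i, cZ i] : Fin 6 → Fin d) k)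
        ((![rx, ry, ry', rz, rx₀, rz₀] : Fin 6 → ZMod n) k) : Fin d → ZMod n) c = 0 := by
    intro c
    have h := congrArg (fun g : Multiplicative (Fin d → ZMod n) => Multiplicative.toAdd g c) hE
    simp only [toAdd_mul, toAdd_inv, toAdd_ofAdd, Pi.add_apply, Pi.neg_apply] at h
    simp only [Fin.sum_univ_six, Matrix.cons_val_zero, Matrix.cons_val_one, Matrix.cons_val,
      neg_smul, one_smul]
    linear_combination h
  by_cases hab : a = i ∧ b = i
  · -- diagonal word: at each axis of the triple exactly two letters of opposite sign survive
    obtain ⟨ha, hb⟩ := hab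
    obtain ⟨h1, h2, h3⟩ := hdiag i
    have eX := hco (cX i)
    have eY := hco (cY i)
    have eZ := hco (cZ i)
    simp only [ha, hb, Fin.sum_univ_six, Matrix.cons_val_zero, Matrix.cons_val_one, Matrix.cons_val,
      Pi.single_eq_same, Pi.single_eq_of_ne h1, Pi.single_eq_of_ne h1.symm, Pi.single_eq_of_ne h2,
      Pi.single_eq_of_ne h2.symm, Pi.single_eq_of_ne h3, Pi.single_eq_of_ne h3.symm, smul_zero,
      neg_smul, one_smul, add_zero, zero_add, neg_add_eq_zero, add_neg_eq_zero] at eX eY eZ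
    rw [ha, hb]
    exact ⟨rfl, rfl, by rw [eX], by rw [eY], by rw [eZ]⟩
  · -- off-diagonal word: the finite core `hoff` gives a letter alone on its axis; it must vanish
    exfalso
    obtain ⟨k₀, hk₀⟩ := hoff i a b hab
    have hr : ∀ k : Fin 6, (![rx, ry, ry', rz, rx₀, rz₀] : Fin 6 → ZMod n) k ≠ 0 := by
      intro k
      fin_cases k <;> assumption
    apply hr k₀
    have h := single_survivor
      (fun k => (Pi.single ((![cX a, cY a, cY b, cZ b, cX i, cZ i] : Fin 6 → Fin d) k)
        ((![rx, ry, ry', rz, rx₀, rz₀] : Fin 6 → ZMod n) k) : Fin d → ZMod n)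
        ((![cX a, cY a, cY b, cZ b, cX i, cZ i] : Fin 6 → Fin d) k₀))
      k₀ (fun k hk => Pi.single_eq_of_ne (hk₀ k hk).symm _) (hco _)
    simpa using h

/-! ### Any coordinate labelling with a certified core is a graded simultaneous family -/

/-- **Coordinate labellings as graded simultaneous families with an abelian base.**  For a labelling
`cX cY cZ : Fin t → Fin d` whose finite core (`hdiag`, `hoff`) is certified, the family of punctured-axis
pieces of `G = Multiplicative (Fin d → ZMod n)`, read through the full test space `J = ⊤`, is
bi-invariant and simultaneously `J`-separated (`coordinate_pattern`, delta functions as tests), every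
piece has volume `(n-1)³`, and the graded budget is at most `|G| = n^d` (abelian base: all irreducible
degrees are `1`); hence the family beats the budget at exponent `2+ε` as soon as
`n^d < t·((n-1)³)^{(2+ε)/3}`.  (Cohn–Kleinberg–Szegedy–Umans 2005, §5, axis example: `d = 3`, `t = 2`.)
[folklore] -/
theorem coordinateFamilyAt (n : ℕ) [NeZero n] {d t : ℕ} (cX cY cZ : Fin t → Fin d)
    (hdiag : ∀ i, cX i ≠ cY i ∧ cY i ≠ cZ i ∧ cZ i ≠ cX i)
    (hoff : ∀ i a b : Fin t, ¬ (a = i ∧ b = i) → ∃ k₀ : Fin 6, ∀ k : Fin 6, k ≠ k₀ →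
      (![cX a, cY a, cY b, cZ b, cX i, cZ i] : Fin 6 → Fin d) k ≠
        (![cX a, cY a, cY b, cZ b, cX i, cZ i] : Fin 6 → Fin d) k₀)
    (ε : ℝ) (hε : (n : ℝ) ^ d < t * ((((n - 1) * (n - 1) * (n - 1) : ℕ)) : ℝ) ^ ((2 + ε) / 3)) :
    ∃ (G : Type) (_ : Group G) (_ : Fintype G)
      (J : Submodule ℂ (G → ℂ)) (t : ℕ) (X Y Z : Fin t → Finset G),
      (∀ f ∈ J, ∀ a b : G, (fun g : G => f (a * g * b)) ∈ J) ∧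
      (∀ i : Fin t, ∀ x₀ ∈ X i, ∀ z₀ ∈ Z i, ∃ f ∈ J, ∀ a b : Fin t, ∀ x ∈ X a, ∀ y ∈ Y a,
        ∀ y' ∈ Y b, ∀ z ∈ Z b,
          ((a = i ∧ b = i ∧ x = x₀ ∧ y = y' ∧ z = z₀) → f (x⁻¹ * y * y'⁻¹ * z) = 1) ∧
          (¬ (a = i ∧ b = i ∧ x = x₀ ∧ y = y' ∧ z = z₀) → f (x⁻¹ * y * y'⁻¹ * z) = 0)) ∧
      (∑ᶠ χ ∈ irrChars G ∩ (J : Set (G → ℂ)), (χ 1).re ^ (2 + ε)) <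
        ∑ i, (((X i).card * (Y i).card * (Z i).card : ℕ) : ℝ) ^ ((2 + ε) / 3) := by
  classical
  refine ⟨Multiplicative (Fin d → ZMod n), inferInstance, inferInstance, ⊤, t,
    fun a => ((Finset.univ : Finset (ZMod n)).erase 0).image
      fun r => Multiplicative.ofAdd (Pi.single (cX a) r),
    fun a => ((Finset.univ : Finset (ZMod n)).erase 0).image
      fun r => Multiplicative.ofAdd (Pi.single (cY a) r),
    fun a => ((Finset.univ : Finset (ZMod n)).erase 0).image
      fun r => Multiplicative.ofAdd (Pi.single (cZ a) r),
    fun f _ a b => Submodule.mem_top, ?_, ?_⟩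
  · -- simultaneous separation by delta functions at the targets
    intro i x₀ hx₀ z₀ hz₀
    refine ⟨fun g => if g = x₀⁻¹ * z₀ then 1 else 0, Submodule.mem_top, ?_⟩
    intro a b x hx y hy y' hy' z hz
    refine ⟨?_, fun hnot => ?_⟩
    · rintro ⟨-, -, rfl, rfl, rfl⟩
      simp
    · dsimp only
      rw [if_neg]
      exact fun hE => hnot (coordinate_pattern cX cY cZ hdiag hoff i a b hx hy hy' hz hx₀ hz₀ hE)
  · -- budget ≤ |G| = n^d < t·((n-1)³)^{(2+ε)/3} = Σ_i V_i^{(2+ε)/3}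
    have hcard : ∀ c : Fin d, (((Finset.univ : Finset (ZMod n)).erase 0).image
        fun r => Multiplicative.ofAdd (Pi.single c r : Fin d → ZMod n)).card = n - 1 := by
      intro c
      have hinj : Function.Injective
          fun r : ZMod n => Multiplicative.ofAdd (Pi.single c r : Fin d → ZMod n) :=
        fun r₁ r₂ h => Pi.single_injective (M := fun _ : Fin d => ZMod n) c
          (Multiplicative.ofAdd.injective h)
      rw [Finset.card_image_of_injective _ hinj, Finset.card_erase_of_mem (Finset.mem_univ _),
        Finset.card_univ, ZMod.card]
    refine lt_of_le_of_lt
      (Negative.gradedBudget_le_card_of_comm (G := Multiplicative (Fin d → ZMod n)) ⊤ (2 + ε)) ?_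
    have hG : (Nat.card (Multiplicative (Fin d → ZMod n)) : ℝ) = (n : ℝ) ^ d := by
      rw [Nat.card_eq_fintype_card, Fintype.card_multiplicative, Fintype.card_fun, ZMod.card,
        Fintype.card_fin]
      push_cast
      rfl
    rw [hG]
    simpa only [hcard, Finset.sum_const, Finset.card_univ, Fintype.card_fin, nsmul_eq_mul] using hε

/-! ### The certificate at `n = 16` and the registered stub -/

/-- **Certificate** for the base inequality at `n = 16`, `t = 2`: `16³ = 4096 < 2·3375^{(2+ε)/3}` for
every `ε ≥ 41/50`, from the exact integer comparison `2048⁵⁰ < 3375⁴⁷` and monotonicity of `rpow` in the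
exponent (`3375 = 15³`, `(2 + 41/50)/3 = 47/50`; the true threshold is `ε > 0.8155…`). [folklore] -/
theorem axis16_certificate (ε : ℝ) (hε : (41 : ℝ) / 50 ≤ ε) :
    ((16 : ℕ) : ℝ) ^ 3 <
      ((2 : ℕ) : ℝ) * ((((16 - 1) * (16 - 1) * (16 - 1) : ℕ)) : ℝ) ^ ((2 + ε) / 3) := by
  have hcast : ((((16 - 1) * (16 - 1) * (16 - 1) : ℕ)) : ℝ) = 3375 := by norm_num
  have h16 : ((16 : ℕ) : ℝ) ^ 3 = 4096 := by norm_num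
  have h2 : ((2 : ℕ) : ℝ) = 2 := by norm_num
  rw [hcast, h16, h2]
  have hmono : (3375 : ℝ) ^ ((47 : ℝ) / 50) ≤ (3375 : ℝ) ^ ((2 + ε) / 3) :=
    Real.rpow_le_rpow_of_exponent_le (by norm_num) (by linarith)
  have hkey : (2048 : ℝ) < (3375 : ℝ) ^ ((47 : ℝ) / 50) := by
    refine lt_of_pow_lt_pow_left₀ 50 (Real.rpow_nonneg (by norm_num) _) ?_
    have hpow : ((3375 : ℝ) ^ ((47 : ℝ) / 50)) ^ (50 : ℕ) = (3375 : ℝ) ^ (47 : ℕ) := by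
      rw [← Real.rpow_natCast, ← Real.rpow_mul (by norm_num), ← Real.rpow_natCast]
      norm_num
    rw [hpow]
    norm_num
  linarith

/-- **The clause of `GradedDesignFamily` at every `ε ≥ 0.82`** (registered stub `cruxAt_of_le_082` of
crux stmt-MatrixMultiplication-7610): a finite group `G`, a bi-invariant test space `J` and a
`J`-separated triple beating the graded budget `Σ_{χ ∈ Irr G ∩ J} χ(1)^{2+ε}` at exponent `2 + ε`.
Proof: the landed graded wreath lift `gradedWreathLinkAt` fed with the axis family of `C₁₆³`, whose
finite core is decided (`decide`) and whose budget inequality is the certificate `axis16_certificate`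
(Cohn–Kleinberg–Szegedy–Umans 2005, §5 + Thm. 7.1: `ω ≤ 2.82` from the first STPP example). [folklore] -/
theorem cruxAt_of_le_082 (ε : ℝ) (hε : (41 : ℝ) / 50 ≤ ε) :
    ∃ (G : Type) (_ : Group G) (_ : Fintype G) (J : Submodule ℂ (G → ℂ)) (X Y Z : Finset G),
      (∀ f ∈ J, ∀ a b : G, (fun g : G => f (a * g * b)) ∈ J) ∧
      (∀ x₀ ∈ X, ∀ z₀ ∈ Z, ∃ f ∈ J, ∀ x ∈ X, ∀ y ∈ Y, ∀ y' ∈ Y, ∀ z ∈ Z,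
        (x = x₀ ∧ y = y' ∧ z = z₀ → f (x⁻¹ * y * y'⁻¹ * z) = 1) ∧
        (¬ (x = x₀ ∧ y = y' ∧ z = z₀) → f (x⁻¹ * y * y'⁻¹ * z) = 0)) ∧
      (∑ᶠ χ ∈ Literature.RepresentationTheory.FiniteGroups.irrChars G ∩ (J : Set (G → ℂ)),
        (χ 1).re ^ (2 + ε)) < ((X.card * Y.card * Z.card : ℕ) : ℝ) ^ ((2 + ε) / 3) :=
  gradedWreathLinkAt ε (by linarith)
    (coordinateFamilyAt 16 (![0, 1] : Fin 2 → Fin 3) (![1, 2] : Fin 2 → Fin 3)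
      (![2, 0] : Fin 2 → Fin 3) (by decide) (by decide) ε (axis16_certificate ε hε))

end Summit.MatrixMultiplication.MatrixMultiplication.Theorems.GradedDesignFamily.AxisCertificate

end
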